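import Mathlib
import Literature.NumberTheory.LFunctions.Zhang2022.TypedSection12C
import Literature.NumberTheory.LFunctions.Zhang2022.Section10cLow1214X
import Literature.NumberTheory.LFunctions.Zhang2022.Section10cLow1214Int
import HarnessLib

/-!
# Zhang (2022) §12 (12.12), second equality: the window sum over `n < P^{0.496}` IS the §10 low-range
# sum of `S_j(𝐚₁₂,𝐚₁₄)` up to the constant `500b*`, hence equals `𝔞b*(log P)β_{j+1}β_{j+2}e*_{1j} + o(α)`

Topic `Literature/NumberTheory/LFunctions/Zhang2022` (Landau–Siegel audit tree; verdict-neutral).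
Y. Zhang, *Discrete mean estimates and the Landau–Siegel zero*, arXiv:2211.02515v1 (2022)
[Zhang2022LandauSiegel] — **an unrefereed manuscript under adjudication; this file proves one displayed
step of it from tree theorems and asserts nothing about its Theorems 1–2.** ZHANG-L discharge lane
(WP12, seat zl-w12-p10), leaf `Typed.Sec12C.Eq1212 c′` (hypothesis `h1212` of
`Skeleton.theorem1_of_leaves_v19`), node `Z22:(12.12)` [Z22 p.71, (12.12), tex L3607–L3612]:

  "the sum over `dr ≤ P″₁/T` is equal to
  `L′(1,χ)²b*β_{j+1}β_{j+2}Σ_{n<P^{0.496}}|χ(n)|λ₀ⱼ(n)φ(n)⁻¹(ῑ₃𝓕_{j6}(P^{0.498}/n)/0.498 + ῑ₄𝓕_{j7}(P^{0.5}/n)/0.5) + o(α)`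
  `= 𝔞b*(log P)β_{j+1}β_{j+2}∫₀^{0.496}(ῑ₃𝔣𝔣_{j6}(0.498−z)/0.498 + ῑ₄𝔣𝔣_{j7}(0.5−z)/0.5)dz + o(α)`".

This file PROVES THE SECOND EQUALITY (window sum → integral), unconditionally: the typed first main
term `main1212sum c′ χ j` and the typed second main term `main1212int c′ χ j` (`TypedSection12C`)
differ by `o(α)` (`eq1212_sum_sub_int`). Route — an OBSERVATION, then two tree theorems: the §10 low
range of `S_j(𝐚₁₂,𝐚₁₄)` (p. 60, tex L3081) carries the SAME profile
`ῑ₃𝓕_{j6}(P^{0.498}/n)/0.498 + ῑ₄𝓕_{j7}(P^{0.5}/n)/0.5` over the SAME window `n < P^{0.496}` with the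
constant `1/500` in place of `b*`:

* `winSum_zero_eq_lamAvg_one` — the §12 window sum from `lo = 0` is the §10 average from `⌈1⌉`;
* `main1212sum_eq` — `main1212sum = 500b*·lowSum1214` (exact);
* `estar1j_eq_integral_shift`, `main1212int_eq` — `e*_{1j} = ∫₀^{0.496}(ῑ₃𝔣𝔣_{j6}(0.002+z)/0.498 +
  ῑ₄𝔣𝔣_{j7}(0.004+z)/0.5)dz` (reflection `z ↦ 0.496 − z`), so `main1212int = 500b*·lowInt1214` (`j ∈ {1,2,3}`);
* `eq1212_sum_sub_int` — `‖main1212sum − main1212int‖ ≤ εα` for all large `D`, from the tree's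
  `Typed.Sec10C.low1214X_holds` (the §8 evaluation rule `L′²Σ|χ|λ₀ⱼ/φ·G = 𝔞∫G dt/t + O(𝓛⁶(M + M′𝓛⁹))`,
  ZHANG-L WP10) and `Typed.Sec10C.low1214Int_holds` (`x = Pᶻ`, `𝓕_{jμ}(Pᵘ) = 𝔣𝔣_{jμ}(u) + O(𝓛⁻⁸)`, sz-d34);
* `eq1212_of_first_equality` — hence the leaf `Eq1212 c′` follows from its FIRST equality alone
  (the arithmetic evaluation of `Σ_{dr≤P″₁/T}` by Lemmas 8.2, 8.3, 12.2, typed inline as the hypothesis).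

Theorem-only: no definition, no new fact, standard axioms. WHAT THIS FILE IS NOT: a proof of the
first equality of (12.12) (it needs Lemma 12.2's (12.10), whose error term is blank in print — GAP row
G-L3t5-1), nor any claim about Theorems 1–2 / Landau–Siegel zeros.

## References

* Y. Zhang, arXiv:2211.02515v1 (2022), §12 (12.12) p.71, tex L3607–L3612; §10 p.60, tex L3081;
  §8 pp.48–49. [cite: Zhang2022LandauSiegel, §12 (12.12) p.71]
-/

noncomputable section

open Complex Real ComplexConjugate
open Literature.NumberTheory.LFunctions.Zhang2022.Skeleton

namespace Literature.NumberTheory.LFunctions.Zhang2022.Typed.Sec12C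

section Eq1212Integral

variable (c' : ℝ) {D : ℕ} [NeZero D] (χ : DirichletCharacter ℂ D)

omit [NeZero D] in
/-- The §12 window sum from `lo = 0` is the §10 weighted average from `⌈1⌉ = 1`: both are
`Σ_{1≤n<⌈hi⌉}|χ(n)|λ₀ⱼ(n)φ(n)⁻¹w(n)`. [cite: Zhang2022LandauSiegel, §8 (8.10) p.47] -/
theorem winSum_zero_eq_lamAvg_one (j : ℕ) (hi : ℝ) (w : ℕ → ℂ) :
    winSum c' χ j 0 hi w = Sec10C.lamAvg c' χ j 1 hi w := by
  unfold winSum Sec10C.lamAvg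
  rw [Nat.ceil_one, Finset.filter_true_of_mem]
  intro n hn
  rw [Finset.mem_Ico] at hn
  exact_mod_cast hn.1

/-- **`main1212sum = 500b*·lowSum1214`**: the first main term of (12.12) is the §10 low-range sum of
`S_j(𝐚₁₂,𝐚₁₄)` (p. 60, constant `1/500`) rescaled by `500b*` — same profile, same window.
[cite: Zhang2022LandauSiegel, §12 (12.12) p.71; §10 p.60] -/
theorem main1212sum_eq (j : ℕ) :
    main1212sum c' χ j = 500 * bstar * Sec10C.lowSum1214 c' χ j := by
  rw [main1212sum, Sec10C.lowSum1214, winSum_zero_eq_lamAvg_one]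
  ring

/-- The `j`-indexed bridges agree: `ffj j 6 = ffJ6 j`, `ffj j 7 = ffJ7 j` for `j ∈ {1,2,3}` (both are
`𝔣𝔣_{jμ}` of (8.13)–(8.18)). [cite: Zhang2022LandauSiegel, §8 (8.13)–(8.18) p.49] -/
theorem ffj_eq_ffJ {j : ℕ} (hj : j ∈ ({1, 2, 3} : Finset ℕ)) :
    ffj j 6 = Sec10C.ffJ6 j ∧ ffj j 7 = Sec10C.ffJ7 j := by
  simp only [Finset.mem_insert, Finset.mem_singleton] at hj
  rcases hj with rfl | rfl | rfl <;> simp [ffj, Sec10C.ffJ6, Sec10C.ffJ7, Sec10C.byJ]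

/-- **`e*_{1j}` after the reflection `z ↦ 0.496 − z`**: `e*_{1j} = ∫₀^{0.496}(ῑ₃𝔣𝔣_{j6}(0.002+z)/0.498 +
ῑ₄𝔣𝔣_{j7}(0.004+z)/0.5)dz` (`j ∈ {1,2,3}`), the integrand of the §10 node `lowInt1214`.
[cite: Zhang2022LandauSiegel, §12 (12.15) p.72; §10 p.60] -/
theorem estar1j_eq_integral_shift {j : ℕ} (hj : j ∈ ({1, 2, 3} : Finset ℕ)) :
    estar1j j = ∫ z in (0:ℝ)..0.496,
      (conj iota3 * Sec10C.ffJ6 j (0.002 + z) / 0.498 + conj iota4 * Sec10C.ffJ7 j (0.004 + z) / 0.5) := by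
  obtain ⟨h6, h7⟩ := ffj_eq_ffJ hj
  rw [estar1j_def, h6, h7]
  have key := intervalIntegral.integral_comp_sub_left
    (fun z : ℝ => conj iota3 * Sec10C.ffJ6 j (0.002 + z) / 0.498 +
      conj iota4 * Sec10C.ffJ7 j (0.004 + z) / 0.5) (0.496 : ℝ) (a := 0) (b := 0.496)
  have e1 : ∀ z : ℝ, (0.002 : ℝ) + (0.496 - z) = 0.498 - z := fun z => by ring
  have e2 : ∀ z : ℝ, (0.004 : ℝ) + (0.496 - z) = 0.5 - z := fun z => by ring
  simp only [e1, e2, sub_self, sub_zero] at key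
  rw [key]

/-- **`main1212int = 500b*·lowInt1214`** (`j ∈ {1,2,3}`): the second main term of (12.12) is the §10
low-range integral rescaled by `500b*`. [cite: Zhang2022LandauSiegel, §12 (12.12) p.71; §10 p.60] -/
theorem main1212int_eq {j : ℕ} (hj : j ∈ ({1, 2, 3} : Finset ℕ)) :
    main1212int c' χ j = 500 * bstar * Sec10C.lowInt1214 c' χ j := by
  rw [main1212int, Sec10C.lowInt1214, estar1j_eq_integral_shift hj]
  ring

/-- **(12.12), second equality, HOLDS**: for every `ε > 0` and all large `D`,
`‖main1212sum − main1212int‖ ≤ εα` for `j ∈ {1,2,3}` — the window sum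
`L′²b*β_{j+1}β_{j+2}Σ_{n<P^{0.496}}|χ(n)|λ₀ⱼ(n)φ(n)⁻¹(…)` equals `𝔞b*(log P)β_{j+1}β_{j+2}e*_{1j} + o(α)`;
by `main1212sum_eq`/`main1212int_eq` this is `500‖b*‖` times the §10 chain `lowSum1214 → lowX1214 →
lowInt1214` (`Typed.Sec10C.low1214X_holds`, `low1214Int_holds`). Unconditional in (A).
[cite: Zhang2022LandauSiegel, §12 (12.12) p.71, tex L3607–L3612] -/
theorem eq1212_sum_sub_int : ∀ ε : ℝ, 0 < ε → ForAllLarge fun D _ χ => AssumptionA D χ →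
    ∀ j ∈ ({1, 2, 3} : Finset ℕ), ‖main1212sum c' χ j - main1212int c' χ j‖ ≤ ε * alpha D := by
  intro ε hε
  set K : ℝ := 500 * ‖bstar‖ + 1 with hK
  have hK0 : 0 < K := by positivity
  have hε' : 0 < ε / (2 * K) := by positivity
  refine ((Sec10C.low1214X_holds c' _ hε').and (Sec10C.low1214Int_holds c' _ hε')).mono ?_
  intro D _ χ _ _ ⟨hX, hI⟩ hA j hj
  have h1 := hX hA j hj
  have h2 := hI hA j hj
  rw [main1212sum_eq, main1212int_eq c' χ hj, ← mul_sub, norm_mul]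
  have hn : ‖(500 : ℂ) * bstar‖ = 500 * ‖bstar‖ := by
    rw [norm_mul]; norm_num
  rw [hn]
  have htri : ‖Sec10C.lowSum1214 c' χ j - Sec10C.lowInt1214 c' χ j‖ ≤
      ε / (2 * K) * alpha D + ε / (2 * K) * alpha D := by
    calc ‖Sec10C.lowSum1214 c' χ j - Sec10C.lowInt1214 c' χ j‖
        = ‖(Sec10C.lowSum1214 c' χ j - Sec10C.lowX1214 c' χ j) +
            (Sec10C.lowX1214 c' χ j - Sec10C.lowInt1214 c' χ j)‖ := by ring_nf
      _ ≤ _ := (norm_add_le _ _).trans (add_le_add h1 h2)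
  calc 500 * ‖bstar‖ * ‖Sec10C.lowSum1214 c' χ j - Sec10C.lowInt1214 c' χ j‖
      ≤ K * (ε / (2 * K) * alpha D + ε / (2 * K) * alpha D) :=
        mul_le_mul (by linarith) htri (norm_nonneg _) hK0.le
    _ = ε * alpha D := by field_simp; ring

/-- **The leaf `Eq1212 c′` from its first equality alone**: if for every `ε > 0` and all large `D`
(under (A), for the printed `𝐚₂₅`) `‖Σ_{dr≤P″₁/T}(S_j-summand) − main1212sum‖ ≤ εα`, then (12.12) as typed
(both equalities) holds. [cite: Zhang2022LandauSiegel, §12 (12.12) p.71, tex L3607–L3612] -/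
theorem eq1212_of_first_equality
    (h : ∀ ε : ℝ, 0 < ε → ForAllLarge fun D _ χ => AssumptionA D χ →
      ∀ a25 : ℕ → ℂ, (∀ n, a25 n = conj (χ (n : ZMod D) * vk13 D n)) →
        ∀ j ∈ ({1, 2, 3} : Finset ℕ),
          ‖SjOn c' D j (a12 χ) a25 (rngLow D) - main1212sum c' χ j‖ ≤ ε * alpha D) :
    Eq1212 c' := by
  intro ε hε
  have hε2 : 0 < ε / 2 := by positivity
  refine ((h _ hε2).and (eq1212_sum_sub_int c' _ hε2)).mono ?_
  intro D _ χ _ _ ⟨hS, hI⟩ hA a25 ha25 j hj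
  have h1 := hS hA a25 ha25 j hj
  have h2 := hI hA j hj
  have hα : 0 ≤ alpha D :=
    nonneg_of_mul_nonneg_right ((norm_nonneg _).trans h1) hε2
  refine ⟨h1.trans (by nlinarith), ?_⟩
  calc ‖SjOn c' D j (a12 χ) a25 (rngLow D) - main1212int c' χ j‖
      = ‖(SjOn c' D j (a12 χ) a25 (rngLow D) - main1212sum c' χ j) +
          (main1212sum c' χ j - main1212int c' χ j)‖ := by ring_nf
    _ ≤ ε / 2 * alpha D + ε / 2 * alpha D := (norm_add_le _ _).trans (add_le_add h1 h2)
    _ = ε * alpha D := by ring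

end Eq1212Integral

end Literature.NumberTheory.LFunctions.Zhang2022.Typed.Sec12C
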